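import Summits.BirchSwinnertonDyer.BirchSwinnertonDyer.Theorems.RamifiedHeegnerPairLeafRankOneUpperAtThreeShimuraInert
import Summits.BirchSwinnertonDyer.BirchSwinnertonDyer.Theorems.RamifiedHeegnerPairLeafRankOneUpperAtThreeMonoCarrierAny
import HarnessLib

/-!
# Route `RamifiedHeegnerPair`, crux U₁ `LeafRankOneUpperAtThree` (stmt-BirchSwinnertonDyer-26022), line `splitkolyvagin` —
# the INERT-CARRIER (Shimura-curve) road, part 3: the partner's lower half from L₀, and THE RE-THREADED COMPOSITION
# `LeafRankOneUpperAtThree` ⟸ PUB⁺ ∧ F1–F3 ∧ SHIMURA FACTS ∧ Σ★⁗ ∧ L₀ (skeleton v9), where the research stub Σ★⁗ is Σ★‴ OFF the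
# «Shimura rows»

HONEST FRAMING. Theorems only; helper file (`--supports stmt-BirchSwinnertonDyer-26022 --as helper`); nothing is booked, no item is
closed, BSD is not proved for any curve; CONDITIONAL on every displayed input. Lead prover bsd-line-rhp-p2 g10, 2026-08-28. Parts 1–2:
`…LeafShimuraInertTools.lean` (p649134), `…LeafRankOneUpperAtThreeShimuraInert.lean`.

* §3 `partnerLowerSplitThree_of_lowerRankZero` — at an odd imaginary quadratic field with `3` split, the minimal twist of a leaf
  curve is a rank-zero LEAF curve (part 1 `leaf_twist_of_split_three`), so the route member L₀ `Gss2LowerAtThreeRankZero` (item 26023)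
  pays its lower half; `leafRankOneUpper_three_of_shimuraInert_of_lowerRankZero_of_two_dvd` — U₁ at a leaf curve with `2 ∣ N_E` on
  a Shimura row from seven named facts + L₀, NO Σ-type input.
* §4 `sigmaStarOptOffShimuraRows_of_sigmaStarOptOffMonoRows` — Σ★‴ ⟹ Σ★⁗ (weakening: one more negated row binder), so item
  27493 ⟹ Σ★″ ⟹ Σ★‴ ⟹ Σ★⁗;
  `leafRankOneUpperAtThree_of_pubManin_of_namedFacts_of_shimuraFacts_of_sigmaStarOptOffShimuraRows_of_lowerRankZero` — THE
  COMPOSITION of skeleton v9: `LeafRankOnePrintedInputsAtThree → F1 → F2 → F3 → JL → Pasten §6 → CST14+JSW17 → FH-inert → Σ★⁗ → L₀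
  → LeafRankOneUpperAtThree` (conclusion literally the route decl). Proof: optimal member `W₀ ∼ W` (modularity), THREE-WAY row
  split at `W₀` — Shimura row: §3; mono-carrier row: the any-carrier reading (p643642/p645042); otherwise Σ★⁗ at the datum
  (p610955 §1) —, transport back (Cassels + GZK).

THE SHIMURA ROWS (the new binder, verbatim in Σ★⁗): `2 ∣ N` ∧ SHAPE «`3 ∣ c_q ⇒ q` split multiplicative» ∧ `∃ S` even set of
multiplicative primes with every split-multiplicative carrier inside and (DEG)-availability (Pasten Lemma 6.15 | 6.16 | 6.18). Census
(rank-one Gss2, `N < 5·10⁵`, lead's count on trib-w g11 data): of the 238 multi-carrier classes Σ★‴ was asked on, 93 are Shimura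
rows as typed (116 without the `2 ∣ N` clause — the odd-`d_K` supply for `2 ∤ N` is a Friedberg–Hoffstein variant not yet typed;
123 with the `q = 2` cokernel clause); Σ★⁗'s content = 109 classes with an additive `IV/IV*` carrier + 6 with both carriers
`≡ 1 (mod 3)` and no (ram) pair + the `2 ∤ N` Shimura-shaped rows. BSD is not proved; U₁ / L₀ / Σ★⁗ OPEN.
References: [cite: JetchevSkinnerWan2017, §7.4.2 (p. 31), Thm. 4.4.1 (p. 19)] [cite: CaiShuTian2014, Thm. 1.5]
[cite: PastenShimura2024, Prop. 6.13, Lemmas 6.8, 6.14–6.16, 6.18 (pp. 22–25)] [cite: FriedbergHoffstein1995, Thm. B]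
[cite: Jetchev2008, Conj. 1.3, Thm. 1.4 (p. 812)] [cite: MatarNekovar2019, Thm. 0.7 (p. 456)] [cite: Miller2011LMS, Def. 1.1]
[cite: Mazur1978, Cor. 4.1] [cite: MilneADT2006, Thm. I.7.3].
-/

-- D-0017: single-problem summit, so `Summit.BirchSwinnertonDyer.BirchSwinnertonDyer.…` repeats a namespace BY DESIGN.
set_option linter.dupNamespace false
set_option autoImplicit false

noncomputable section

open scoped Classical NumberField

open WeierstrassCurve NumberField IsDedekindDomain Literature Literature.NumberTheory.EllipticCurves
  Rat.HeightOneSpectrum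
  Literature.NumberTheory.EllipticCurves.ModularForms
  Literature.NumberTheory.EllipticCurves.Rank1Residual
  Literature.NumberTheory.EllipticCurves.Rank1Residual.Typed
  Literature.NumberTheory.QuadraticFields.Quadratic
  Literature.NumberTheory.Automorphic
  Summit.BirchSwinnertonDyer.Rank1Residual
  Summit.BirchSwinnertonDyer.Rank1Residual.Additive
  Summit.BirchSwinnertonDyer.Rank1Residual.X11b
  Summit.BirchSwinnertonDyer.Rank1Residual.X11b.Three
  Summit.BirchSwinnertonDyer.BirchSwinnertonDyer.Theses.RamifiedHeegnerPair
  Summit.BirchSwinnertonDyer.BirchSwinnertonDyer.Theorems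
  Summit.BirchSwinnertonDyer.BirchSwinnertonDyer.Theorems.RamifiedPairUpperBound

namespace Summit.BirchSwinnertonDyer.BirchSwinnertonDyer.Theorems.LeafShimuraInert

/-! ## §3 The partner's lower half from the route member L₀ (the twist is a rank-zero LEAF curve) -/

/-- **The partner-lower supply from L₀ `Gss2LowerAtThreeRankZero` (item 26023) BY NAME.** For a non-CM leaf curve `W`, every
imaginary quadratic `K` of odd discriminant with `3` split and `L(W^{(d_K)},1) ≠ 0`, and every globally minimal model `Wd` of the
twist: `Wd` is a non-CM LEAF curve (`leaf_twist_of_split_three`) of analytic rank `0` (modularity: `L(Wd,1) ≠ 0`), so L₀ pays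
`Typed.MissingLowerBoundAt Wd 3`. [cite: Miller2011LMS, Def. 1.1] [cite: Knapp1993, Prop. 12.10] -/
theorem partnerLowerSplitThree_of_lowerRankZero (hmod : hasEntireLFunction_rat)
    (hL0 : Summit.BirchSwinnertonDyer.BirchSwinnertonDyer.Theses.RamifiedHeegnerPair.Gss2LowerAtThreeRankZero)
    (W : WeierstrassCurve ℚ) [W.IsElliptic] [W.IsGloballyMinimal]
    (hCM : ¬ W.HasCM) (hadd : Addv W 3) (hsub : SubGss W 3)
    (K : Type) [Field K] [NumberField K] (hK : IsImaginaryQuadratic K) (hodd : Odd (NumberField.discr K))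
    (hH3 : SatisfiesHeegnerHypothesis 3 K) (hLt : (W.quadraticTwist (NumberField.discr K : ℚ)).entireLFunction 1 ≠ 0)
    (Wd : WeierstrassCurve ℚ) [Wd.IsElliptic] [Wd.IsGloballyMinimal] (Cd : VariableChange ℚ)
    (hWd : Cd • W.quadraticTwist (NumberField.discr K : ℚ) = Wd) :
    Typed.MissingLowerBoundAt Wd 3 := by
  obtain ⟨hCMd, haddd, hsubd, -⟩ := leaf_twist_of_split_three W hCM hadd hsub K hK hH3 hodd Wd Cd hWd
  have hD0 : (NumberField.discr K : ℚ) ≠ 0 := by exact_mod_cast NumberField.discr_ne_zero K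
  haveI : (W.quadraticTwist (NumberField.discr K : ℚ)).IsElliptic := W.isElliptic_quadraticTwist hD0
  have hLt' : (W.quadraticTwist (NumberField.discr K : ℚ)).entireLFunction = Wd.entireLFunction := by
    rw [← hWd, entireLFunction_smul]
  have hLd1 : Wd.entireLFunction 1 ≠ 0 := by rw [← hLt']; exact hLt
  have hrd : Wd.analyticRank = 0 := (Wd.analyticRank_eq_zero_iff_holds (hmod Wd)).2 hLd1
  exact hL0 Wd hCMd haddd hsubd hrd

/-- **U₁ AT A LEAF CURVE ON A «SHIMURA ROW» WITH `2 ∣ N_E`, from PUBLISHED named facts and L₀ — no Σ-stub.** §2 with the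
partner-lower supply DISCHARGED by the route member L₀ = `Gss2LowerAtThreeRankZero` (item 26023) through §3. The new road's
per-curve statement: hypotheses = seven named facts of the tree (GZK, modularity ×2, Jacquet–Langlands, Pasten 2024 §6 component
orders, CST14 Thm. 1.5 + JSW17 Thm. 4.4.1, Friedberg–Hoffstein inert form) + L₀ + the row data (a datum with `3 ∤ c`, the inert set
`S`, SHAPE, (DEG)-availability). CONDITIONAL; nothing booked; U₁ / L₀ OPEN; BSD is not proved.
[cite: JetchevSkinnerWan2017, §7.4.2 (p. 31), Thm. 4.4.1 (p. 19)] [cite: CaiShuTian2014, Thm. 1.5]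
[cite: PastenShimura2024, Prop. 6.13, Lemmas 6.15–6.16, 6.18 (pp. 23–25)] [cite: FriedbergHoffstein1995, Thm. B] [cite: Miller2011LMS, Def. 1.1] -/
theorem leafRankOneUpper_three_of_shimuraInert_of_lowerRankZero_of_two_dvd
    -- published inputs (named facts of the tree)
    (hGZK : rank_eq_analyticRank_of_analyticRank_le_one) (hmod : hasEntireLFunction_rat)
    (hnf : exists_isNewformOf) (hJL : nonempty_shimuraParametrizationData)
    (hCO : PastenShimura2024_componentOrders)
    (hHK : shimuraCurve_heegnerPoint_grossZagier_kolyvagin)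
    (hFH : friedbergHoffstein_exists_twist_ne_zero_inertAt)
    -- the route member L₀ BY NAME
    (hL0 : Summit.BirchSwinnertonDyer.BirchSwinnertonDyer.Theses.RamifiedHeegnerPair.Gss2LowerAtThreeRankZero)
    -- the leaf curve with `2 ∣ N_E`, with a datum whose constant is a `3`-unit
    (W : WeierstrassCurve ℚ) [W.IsElliptic] [W.IsGloballyMinimal]
    (hCM : ¬ W.HasCM) (hadd : Addv W 3) (hsub : SubGss W 3) (hr : W.analyticRank = 1) (h2N : 2 ∣ W.conductorNorm ℤ)
    {N : ℕ} [NeZero N] (hN : W.conductorNorm ℤ = N)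
    (Dt : ModularParametrizationData W N) (hc : ¬ (3 : ℤ) ∣ Dt.c)
    -- the inert set, SHAPE and (DEG)-availability, as in §1
    (S : Finset ℕ) (hSeven : Even S.card)
    (hSmult : ∀ ℓ ∈ S, ∃ _ : Fact ℓ.Prime, W.HasMultiplicativeReductionAtPrime ℓ)
    (hFC : ∀ (ℓ : ℕ) [Fact ℓ.Prime], ℓ ∉ S → W.HasSplitMultiplicativeReductionAtPrime ℓ →
      ¬ 3 ∣ padicValInt ℓ W.minimalDiscriminantInt)
    (hshape : ∀ (q : ℕ) [Fact q.Prime], 3 ∣ (W.baseChange ℚ_[q]).localTamagawaNumber ℤ_[q] →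
      W.HasSplitMultiplicativeReductionAtPrime q)
    (hDEG : (∃ ℓ₀ ∈ S, ¬ 3 ∣ padicValInt ℓ₀ W.minimalDiscriminantInt) ∨
      (∃ ℓ₀ t : ℕ, ∃ _ : Fact ℓ₀.Prime, ∃ _ : Fact t.Prime,
        W.HasMultiplicativeReductionAtPrime ℓ₀ ∧ W.HasMultiplicativeReductionAtPrime t ∧
        ℓ₀ ∉ S ∧ t ∉ S ∧ t ≠ ℓ₀ ∧ ¬ 3 ∣ padicValInt ℓ₀ W.minimalDiscriminantInt) ∨
      (∃ q₁ q₂ : ℕ, S = {q₁, q₂} ∧ q₁ ≠ q₂ ∧ q₂ ≠ 2 ∧ q₂ % 3 ≠ 1)) :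
    Typed.MissingUpperBoundAt W 3 :=
  leafRankOneUpper_three_of_shimuraInert_of_partnerLower_of_two_dvd hGZK hmod hnf hJL hCO hHK hFH W hadd hsub hr h2N hN Dt
    hc S hSeven hSmult hFC hshape hDEG
    (fun K _ _ hK hodd hH3 hLt Wd _ _ Cd hWd ↦
      partnerLowerSplitThree_of_lowerRankZero hmod hL0 W hCM hadd hsub K hK hodd hH3 hLt Wd Cd hWd)


/-! ## §4 Σ★‴ ⟹ Σ★⁗, and the re-threaded composition (skeleton v9) -/

/-- **Σ★‴ ⟹ Σ★⁗** (weakening: Σ★⁗ is Σ★‴'s text with ONE more negated row binder «not a Shimura row» inserted after the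
mono-carrier negation; every instance of Σ★⁗ is an instance of Σ★‴ with that binder dropped). Hence item 27493 (Σ★″) ⟹ Σ★‴
(p645042 `sigmaStarOptOffMonoRows_of_sigmaStarOptOffRows`) ⟹ Σ★⁗. [cite: Jetchev2008, Conj. 1.3 (p. 812)] -/
theorem sigmaStarOptOffShimuraRows_of_sigmaStarOptOffMonoRows
    (hStar : ∀ (W : WeierstrassCurve ℚ) [W.IsElliptic] [W.IsGloballyMinimal] (N : ℕ) [NeZero N]
      (K : Type) [Field K] [NumberField K]
      (Dt : ModularParametrizationData W N) (H : HeegnerDatum N (NumberField.discr K)) (ι : K →+* ℂ)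
      (P : (W.baseChange K).toAffine.Point),
      ¬ W.HasCM → Addv W 3 → SubGss W 3 → W.conductorNorm ℤ = N →
      (∀ z ∈ Dt.L.lattice, ∃ w ∈ periodLattice Dt.f, z = Dt.c * w) →
      ¬ (∃ (q : ℕ) (_ : Fact q.Prime), q ∣ N ∧
          padicValNat 3 W.tamagawaProduct ≤ padicValNat 3 ((W.baseChange ℚ_[q]).localTamagawaNumber ℤ_[q])) →
      IsImaginaryQuadratic K → SatisfiesHeegnerHypothesis N K →
      (WeierstrassCurve.Affine.Point.map ι.toRatAlgHom) P = heegnerPointComplex Dt H →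
      ¬ IsOfFinAddOrder P → Odd (NumberField.discr K) →
      ∀ (s' : ℕ), s' ≤ padicValNat 3 W.tamagawaProduct + padicValNat 3 Dt.c.natAbs →
      ∀ (n : ℕ) (d : KolyvaginHeegnerData Dt H.β ι n), Squarefree n →
      (∀ ℓ ∈ n.primeFactors, Zhang2014.IsKolyvaginPrime N W K 3 ℓ ∧ s' ≤ Zhang2014.kolyvaginIndex W 3 ℓ) →
      Koly.PDiv d 3 s') :
    ∀ (W : WeierstrassCurve ℚ) [W.IsElliptic] [W.IsGloballyMinimal] (N : ℕ) [NeZero N]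
      (K : Type) [Field K] [NumberField K]
      (Dt : ModularParametrizationData W N) (H : HeegnerDatum N (NumberField.discr K)) (ι : K →+* ℂ)
      (P : (W.baseChange K).toAffine.Point),
      ¬ W.HasCM → Addv W 3 → SubGss W 3 → W.conductorNorm ℤ = N →
      (∀ z ∈ Dt.L.lattice, ∃ w ∈ periodLattice Dt.f, z = Dt.c * w) →
      ¬ (∃ (q : ℕ) (_ : Fact q.Prime), q ∣ N ∧
          padicValNat 3 W.tamagawaProduct ≤ padicValNat 3 ((W.baseChange ℚ_[q]).localTamagawaNumber ℤ_[q])) →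
      ¬ (2 ∣ N ∧
          (∀ (q : ℕ) [Fact q.Prime], 3 ∣ (W.baseChange ℚ_[q]).localTamagawaNumber ℤ_[q] →
            W.HasSplitMultiplicativeReductionAtPrime q) ∧
          ∃ S : Finset ℕ, Even S.card ∧ (∀ ℓ ∈ S, ∃ _ : Fact ℓ.Prime, W.HasMultiplicativeReductionAtPrime ℓ) ∧
            (∀ (ℓ : ℕ) [Fact ℓ.Prime], ℓ ∉ S → W.HasSplitMultiplicativeReductionAtPrime ℓ →
              ¬ 3 ∣ padicValInt ℓ W.minimalDiscriminantInt) ∧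
            ((∃ ℓ₀ ∈ S, ¬ 3 ∣ padicValInt ℓ₀ W.minimalDiscriminantInt) ∨
              (∃ ℓ₀ t : ℕ, ∃ _ : Fact ℓ₀.Prime, ∃ _ : Fact t.Prime,
                W.HasMultiplicativeReductionAtPrime ℓ₀ ∧ W.HasMultiplicativeReductionAtPrime t ∧
                ℓ₀ ∉ S ∧ t ∉ S ∧ t ≠ ℓ₀ ∧ ¬ 3 ∣ padicValInt ℓ₀ W.minimalDiscriminantInt) ∨
              (∃ q₁ q₂ : ℕ, S = {q₁, q₂} ∧ q₁ ≠ q₂ ∧ q₂ ≠ 2 ∧ q₂ % 3 ≠ 1))) →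
      IsImaginaryQuadratic K → SatisfiesHeegnerHypothesis N K →
      (WeierstrassCurve.Affine.Point.map ι.toRatAlgHom) P = heegnerPointComplex Dt H →
      ¬ IsOfFinAddOrder P → Odd (NumberField.discr K) →
      ∀ (s' : ℕ), s' ≤ padicValNat 3 W.tamagawaProduct + padicValNat 3 Dt.c.natAbs →
      ∀ (n : ℕ) (d : KolyvaginHeegnerData Dt H.β ι n), Squarefree n →
      (∀ ℓ ∈ n.primeFactors, Zhang2014.IsKolyvaginPrime N W K 3 ℓ ∧ s' ≤ Zhang2014.kolyvaginIndex W 3 ℓ) →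
      Koly.PDiv d 3 s' :=
  fun W _ _ N _ K _ _ Dt H ι P hCM hadd hsub hN hopt hrow _ hK hHN hP hnt hodd s' hs' n d hn hℓ ↦
    hStar W N K Dt H ι P hCM hadd hsub hN hopt hrow hK hHN hP hnt hodd s' hs' n d hn hℓ

/-- **`LeafRankOneUpperAtThree` ⟸ PUB⁺ ∧ F1–F3 ∧ SHIMURA FACTS ∧ Σ★⁗ ∧ L₀ — the composition of skeleton v9** (conclusion literally
the route decl). Hypotheses BY NAME: PUB⁺ = item 27491 `LeafRankOnePrintedInputsAtThree`; F1–F3 (Gross 3.7 (2) image-free,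
Poitou–Tate for Selmer structures, GZ86 III (3.1) image-free); the four Shimura-road facts `nonempty_shimuraParametrizationData`
(Jacquet–Langlands), `PastenShimura2024_componentOrders` (Pasten 2024 §6 = Ribet–Takahashi + Papikian–Rabinoff),
`shimuraCurve_heegnerPoint_grossZagier_kolyvagin` (CST14 Thm. 1.5 + JSW17 Thm. 4.4.1), `friedbergHoffstein_exists_twist_ne_zero_inertAt`;
the research stub Σ★⁗ (Σ★‴ off the Shimura rows); L₀ = item 26023 `Gss2LowerAtThreeRankZero`. Proof: optimal member `W₀ ∼ W`
(`exists_optimal_leaf_member`; its lattice-optimal datum has `3 ∤ c`, `not_three_dvd_c_of_latticeOptimal_of_subGss`), then at `W₀`: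
Shimura row ⇒ §3; else mono-carrier row ⇒ the any-carrier reading R|₂ from F1–F3
(`leafRankOneUpper_three_monoCarrierAny_of_anyCarrierReading_of_lowerRankZero`); else Σ★⁗ at the datum
(`leafRankOneUpper_three_of_sigmaAtDatum_of_lowerRankZero`); transport back to `W` (Cassels + GZK). CONDITIONAL on every displayed
input; U₁ stays OPEN; BSD is not proved. [cite: JetchevSkinnerWan2017, §7.4.2 (p. 31), Thm. 4.4.1 (p. 19)] [cite: CaiShuTian2014, Thm. 1.5]
[cite: PastenShimura2024, Prop. 6.13, Lemmas 6.15–6.16, 6.18 (pp. 23–25)] [cite: Jetchev2008, Conj. 1.3, Thm. 1.4 (p. 812)]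
[cite: GrossLMS1991, Prop. 3.7 (2) (p. 240)] [cite: MatarNekovar2019, Thm. 0.7 (p. 456)] [cite: FriedbergHoffstein1995, Thm. B]
[cite: Mazur1978, Cor. 4.1] [cite: MilneADT2006, Thm. I.7.3] [cite: Miller2011LMS, Def. 1.1] -/
theorem leafRankOneUpperAtThree_of_pubManin_of_namedFacts_of_shimuraFacts_of_sigmaStarOptOffShimuraRows_of_lowerRankZero
    (hpub : LeafRankOnePrintedInputsAtThree)
    (h37 : GrossLMS1991.prop37_2_frobeniusCongruence)
    (hPT : ∀ (K : Type) [Field K] [NumberField K],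
      Literature.NumberTheory.GaloisCohomology.poitouTate_selmerStructure_duality_conj K)
    (hF1 : Gross1991_heegnerPoint_sub_ratTorsion_mem_E0_imageFree)
    (hJL : nonempty_shimuraParametrizationData) (hCO : PastenShimura2024_componentOrders)
    (hHK : shimuraCurve_heegnerPoint_grossZagier_kolyvagin)
    (hFHi : friedbergHoffstein_exists_twist_ne_zero_inertAt)
    (hStar : ∀ (W : WeierstrassCurve ℚ) [W.IsElliptic] [W.IsGloballyMinimal] (N : ℕ) [NeZero N]
      (K : Type) [Field K] [NumberField K]
      (Dt : ModularParametrizationData W N) (H : HeegnerDatum N (NumberField.discr K)) (ι : K →+* ℂ)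
      (P : (W.baseChange K).toAffine.Point),
      ¬ W.HasCM → Addv W 3 → SubGss W 3 → W.conductorNorm ℤ = N →
      (∀ z ∈ Dt.L.lattice, ∃ w ∈ periodLattice Dt.f, z = Dt.c * w) →
      ¬ (∃ (q : ℕ) (_ : Fact q.Prime), q ∣ N ∧
          padicValNat 3 W.tamagawaProduct ≤ padicValNat 3 ((W.baseChange ℚ_[q]).localTamagawaNumber ℤ_[q])) →
      ¬ (2 ∣ N ∧
          (∀ (q : ℕ) [Fact q.Prime], 3 ∣ (W.baseChange ℚ_[q]).localTamagawaNumber ℤ_[q] →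
            W.HasSplitMultiplicativeReductionAtPrime q) ∧
          ∃ S : Finset ℕ, Even S.card ∧ (∀ ℓ ∈ S, ∃ _ : Fact ℓ.Prime, W.HasMultiplicativeReductionAtPrime ℓ) ∧
            (∀ (ℓ : ℕ) [Fact ℓ.Prime], ℓ ∉ S → W.HasSplitMultiplicativeReductionAtPrime ℓ →
              ¬ 3 ∣ padicValInt ℓ W.minimalDiscriminantInt) ∧
            ((∃ ℓ₀ ∈ S, ¬ 3 ∣ padicValInt ℓ₀ W.minimalDiscriminantInt) ∨
              (∃ ℓ₀ t : ℕ, ∃ _ : Fact ℓ₀.Prime, ∃ _ : Fact t.Prime,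
                W.HasMultiplicativeReductionAtPrime ℓ₀ ∧ W.HasMultiplicativeReductionAtPrime t ∧
                ℓ₀ ∉ S ∧ t ∉ S ∧ t ≠ ℓ₀ ∧ ¬ 3 ∣ padicValInt ℓ₀ W.minimalDiscriminantInt) ∨
              (∃ q₁ q₂ : ℕ, S = {q₁, q₂} ∧ q₁ ≠ q₂ ∧ q₂ ≠ 2 ∧ q₂ % 3 ≠ 1))) →
      IsImaginaryQuadratic K → SatisfiesHeegnerHypothesis N K →
      (WeierstrassCurve.Affine.Point.map ι.toRatAlgHom) P = heegnerPointComplex Dt H →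
      ¬ IsOfFinAddOrder P → Odd (NumberField.discr K) →
      ∀ (s' : ℕ), s' ≤ padicValNat 3 W.tamagawaProduct + padicValNat 3 Dt.c.natAbs →
      ∀ (n : ℕ) (d : KolyvaginHeegnerData Dt H.β ι n), Squarefree n →
      (∀ ℓ ∈ n.primeFactors, Zhang2014.IsKolyvaginPrime N W K 3 ℓ ∧ s' ≤ Zhang2014.kolyvaginIndex W 3 ℓ) →
      Koly.PDiv d 3 s')
    (hL0 : Gss2LowerAtThreeRankZero) :
    LeafRankOneUpperAtThree := by
  intro W _ _ hCM hadd hsub hr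
  obtain ⟨hGZ, hKo, hGZK, hmod, hGZ73, hMN, hnf, hFH, -, hCassels, hM, hAU, hC2⟩ := hpub
  haveI : Fact (Nat.Prime 3) := ⟨Nat.prime_three⟩
  have hR₂ := JetchevReadingAnyCarrier.anyCarrierTwoSplitReading_of_namedFacts h37 hPT hF1
  obtain ⟨W₀, hW₀, hW₀', N, hN0, D₀, hiso, hN₀, -, hopt, hCM₀, hadd₀, hsub₀, hr₀⟩ :=
    exists_optimal_leaf_member hnf W hCM hadd hsub
  haveI := hW₀
  haveI := hW₀'
  haveI := hN0
  have hr₀' : W₀.analyticRank = 1 := hr₀.trans hr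
  -- settle U₁ at the optimal member `W₀` by the three-way row split
  have h₀ : MissingUpperBoundAt W₀ 3 := by
    subst hN₀
    have hc : ¬ (3 : ℤ) ∣ D₀.c := not_three_dvd_c_of_latticeOptimal_of_subGss hM hAU hC2 hnf W₀ D₀ hopt hadd₀ hsub₀
    by_cases hSh : (2 ∣ W₀.conductorNorm ℤ ∧
          (∀ (q : ℕ) [Fact q.Prime], 3 ∣ (W₀.baseChange ℚ_[q]).localTamagawaNumber ℤ_[q] →
            W₀.HasSplitMultiplicativeReductionAtPrime q) ∧
          ∃ S : Finset ℕ, Even S.card ∧ (∀ ℓ ∈ S, ∃ _ : Fact ℓ.Prime, W₀.HasMultiplicativeReductionAtPrime ℓ) ∧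
            (∀ (ℓ : ℕ) [Fact ℓ.Prime], ℓ ∉ S → W₀.HasSplitMultiplicativeReductionAtPrime ℓ →
              ¬ 3 ∣ padicValInt ℓ W₀.minimalDiscriminantInt) ∧
            ((∃ ℓ₀ ∈ S, ¬ 3 ∣ padicValInt ℓ₀ W₀.minimalDiscriminantInt) ∨
              (∃ ℓ₀ t : ℕ, ∃ _ : Fact ℓ₀.Prime, ∃ _ : Fact t.Prime,
                W₀.HasMultiplicativeReductionAtPrime ℓ₀ ∧ W₀.HasMultiplicativeReductionAtPrime t ∧
                ℓ₀ ∉ S ∧ t ∉ S ∧ t ≠ ℓ₀ ∧ ¬ 3 ∣ padicValInt ℓ₀ W₀.minimalDiscriminantInt) ∨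
              (∃ q₁ q₂ : ℕ, S = {q₁, q₂} ∧ q₁ ≠ q₂ ∧ q₂ ≠ 2 ∧ q₂ % 3 ≠ 1)))
    · -- a Shimura row: the inert-carrier road (§3), no Σ
      obtain ⟨h2N, hshape, S, hSeven, hSmult, hFC, hDEG⟩ := hSh
      exact leafRankOneUpper_three_of_shimuraInert_of_lowerRankZero_of_two_dvd hGZK hmod hnf hJL hCO hHK hFHi hL0 W₀ hCM₀
        hadd₀ hsub₀ hr₀' h2N rfl D₀ hc S hSeven hSmult hFC hshape hDEG
    · by_cases hrow : ∃ (q : ℕ) (_ : Fact q.Prime), q ∣ W₀.conductorNorm ℤ ∧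
          padicValNat 3 W₀.tamagawaProduct ≤ padicValNat 3 ((W₀.baseChange ℚ_[q]).localTamagawaNumber ℤ_[q])
      · -- a mono-carrier row: the any-carrier reading from F1–F3
        obtain ⟨q, _, hqN, hmono⟩ := hrow
        exact leafRankOneUpper_three_monoCarrierAny_of_anyCarrierReading_of_lowerRankZero hGZ hKo hGZK hmod hGZ73 hMN hnf
          hFH hR₂ hL0 W₀ hCM₀ hadd₀ hsub₀ hr₀' q hqN hmono D₀ hc
      · -- the research residue Σ★⁗ at the datum
        exact leafRankOneUpper_three_of_sigmaAtDatum_of_lowerRankZero hGZ hKo hGZK hmod hGZ73 hMN hnf hFH hL0 W₀ hCM₀ hadd₀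
          hsub₀ hr₀' D₀ (fun K _ _ H ι P hK hHN _ hP hnt hodd s' hs' n d hn hℓ ↦
            hStar W₀ (W₀.conductorNorm ℤ) K D₀ H ι P hCM₀ hadd₀ hsub₀ rfl hopt hrow hSh hK hHN hP hnt hodd s' hs' n d hn hℓ)
  -- and transport it back along `W ∼ W₀`
  exact missingUpperBoundAt_of_isIsogenous_of_analyticRank_le_one hCassels hGZK hmod (le_of_eq hr) hiso h₀

end Summit.BirchSwinnertonDyer.BirchSwinnertonDyer.Theorems.LeafShimuraInert

end
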